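import Summits.HodgeConjecture.HodgeConjecture.Theorems.Ring2AbelianAllAndreWeilPencilsCMPower
import Summits.HodgeConjecture.HodgeConjecture.Theorems.Ring2AbelianAllAndreSpreadPencilwise
import HarnessLib

/-!
# Ring 2 · sub-cell AbelianAll (ALL ABELIAN VARIETIES), André axis, part XIX-f — THE WEIL-SIXFOLD ROW IN "HOM ≡ NUM"
# FORM WITH `HC_CM` AND THE SPREADING LEMMA BOTH GONE: **(W_E)₃ ∧ [(Num_t)(3,3) at the `E`-power points of compact
# pencils of abelian sixfolds] ⟹ WeilSixfolds** — conjecture D in codimension 4 on the 7-dimensional total spaces,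
# for the classes `j_{t*} N³(𝒳_t)` supported on a fibre isogenous to `E⁶` (`E` a CM elliptic curve), tested
# against `N³(𝒳)`; the general row R∞ for all `n ≥ 2`; on-path (`HodgeConjecture ⟹` the bracket) and the bracket
# from `HCAtDim (2n)` + spreading

HONEST FRAMING (page 1, verbatim): **research route, not a corollary; conditional on HC_CM plus one named
minimal statement.** Cell line: research route conditional on HC_CM; not a corollary; Q11.4-sentence-2 already
refuted in dim ≥ 3. Nothing in this file proves a case of the Hodge conjecture: the targets
`Theses.SevenfoldWeilCensus.WeilSixfolds` (stmt-2524), `WeilTypeLadder.NonsplitSixfolds` and R∞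
`WeilTypeLadder.WeilClassesImaginaryQuadratic` are reached CONDITIONALLY on the typed OPEN habitat node (W_E)ₙ
(`CMPowerAnchoredCompactWeilPencilsAt n`, part IX) and an explicit "hom ≡ num" bracket; `HC_CM` is ABSENT from §0–§3
(the `E`-power anchor is valid by Tate's theorem, the tree's `EllipticCurve.hodgeConjectureFor_of_isIsogenous_powSucc_of_cm`),
and so is the spreading lemma (it is needed only for the CONVERSE direction, §4).

## Content

Part IX reached `WeilSixfolds` from (W_E)₃ and TRANSPORT / β-Lefschetz at relative dimension `6`; parts XVIII-a–c
turned the lift at a fibre satisfying HC into (Perf_t) ∧ (Num_t); part XIX-e read everything on one pencil. Here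
the anchor fibre is a power of a CM elliptic curve, where HC holds in EVERY degree unconditionally
(`hodgeConjectureFor_fiberOver_of_mem_cmPowerLocus`), so (Perf_t) is a theorem there (part XVIII-b) and
**(Num_t)(n,n) ALONE gives the lift of the Weil class at the anchor, hence its algebraicity on every fibre**
(`map_fiberι_mem_algebraicClasses_of_comap_le_sup`: `W = η + κ`, `κ` dies on every fibre):
* §0 HC at an `E`-power fibre; transport out of a fibre from the lift at that fibre (no binder at all).
* §1 `comap_le_sup_of_numerical_of_mem_cmPowerLocus` — (Num_t)(p,q) ⟹ (L)_t(p) at an `E`-power point, NO `HC_CM`.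
* §2 `mem_algebraicClasses_of_cmPowerWeilPencilsAt_of_numerical` — (W_E)ₙ ∧ [(Num_t)(n,n) at `E`-power points of
  compact pencils of relative dimension `2n`] ⟹ every rational `(n,n)` Weil class on every abelian `2n`-fold of Weil
  type is algebraic; rows **`weilSixfolds_of_cmPowerWeilPencilsAt_of_numerical`** ((W_E)₃ ∧ (Num)^{E}_{3,3} ⟹
  WeilSixfolds — every `ℚ(√-d)`, every discriminant, split or not), `nonsplitSixfolds_…`, R∞
  `weilClassesImaginaryQuadratic_of_cmPowerWeilPencils_of_numerical`. THE PRICE, stated as a find-the-cycle problem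
  (part XVIII-c `numerical_iff_detect`): for each compact `E`-anchored pencil `𝒳⁷ → C` of abelian sixfolds and each
  algebraic 3-cycle `b` on the fibre `𝒳_t ~ E⁶` with `j_{t*} b ≠ 0`, ONE algebraic codimension-3 cycle `a` on the
  7-fold with `j_t^* a · b ≠ 0`. This is WEAKER-OR-EQUAL than part IX's inputs modulo the classical spreading lemma
  ((β′)_6 ⟹ (4)_6 ⟹ (Num)^E, §4) and itself uses neither `HC_CM` nor the spreading lemma nor any named fact.
* §3 ON-PATH: `HodgeConjecture ⟹` the bracket (via part VI's algebraic fixed part and part XVIII-c), so the bracket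
  is a CASE of the summit statement; §4 the bracket from `HCAtDim (2n)` and `SpreadCurve[]` (part XIX-b), i.e. from
  HC for abelian `2n`-folds alone modulo the classical spreading — EXACTNESS up to the spreading lemma and the
  census of the other sixfold classes.
* §5 PENCIL BY PENCIL at an `E`-power point, NO `HC_CM`: (Num_t) in every bidegree ⟺ Abdulali's (1.1)_f on that
  pencil (`numerical_iff_invariantCyclesHoldFor_of_mem_cmPowerLocus`; ⟹ spreading-free, ⟸ granted `SpreadCurve[]`).

EDGE LABELS: §0–§3 K unconditional (no fact, no `HC_CM`); §4 and the ⟸ half of §5 K[SpreadCurve]. No `def`, no `sorry`; axioms standard.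

References: Kleiman1968AlgebraicCycles (§3, D(X)); vanGeemen1994HodgeAV (Lemma 3.7, Thm. 4.3, 5.2–5.12);
Andre1996Motifs (§6.3 p. 33, Lemme 6.3.3); Milne2020HodgeClassesAV (Prop. 1 p. 7); Weil1977HodgeRing;
Markman2025SurveySecant (§12); VoisinHodgeII2003 (§3.3.1, proof of Thm. 10.19).
-/

noncomputable section

set_option linter.dupNamespace false

namespace Summit.HodgeConjecture.HodgeConjecture.Ring2.AbelianAll

open CategoryTheory AlgebraicGeometry
open Literature.AlgebraicGeometry Literature.AlgebraicGeometry.Motives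
open Literature.AlgebraicGeometry.HodgeTheory
open Literature.AlgebraicTopology.SingularHomology (cupProduct)
open Summit.HodgeConjecture.HodgeConjecture
open Summit.HodgeConjecture.HodgeConjecture.Theses
open Summit.HodgeConjecture.HodgeConjecture.Ring2.Hypotheses (cmPowerLocus cmPowerAnchor_valid
  hodgeConjectureFor_iff_of_iso)
open Summit.HodgeConjecture.HodgeConjecture.Ring2.ClassTargets (HCAtDim)
open Summit.HodgeConjecture.HodgeConjecture.WeilTypeLadder (WeilClassesImaginaryQuadratic NonsplitSixfolds
  weilSixfolds_iff_weilClassesOf nonsplitSixfolds_of_weilSixfolds)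

variable {𝒳 S : SchemeOver ℂ}

/-- `SpreadCurve[]` — part XIX-a's hypothesis shape (VERBATIM the body of the Literature named fact
`HodgeTheory.spread_algebraicClasses_over_smoothCurve`); used in §4 only. NOT vendored: no definition is made here.
[cite: VoisinHodgeII2003, §3.3.1 and §10.2.1, proof of Thm. 10.19] [cite: CharlesSchnell2014Notes, Prop. 11.3.11 (proof)] -/
local notation3 (prettyPrint := false) "SpreadCurve[]" =>
  ∀ ⦃d q : ℕ⦄ ⦃T W : SchemeOver ℂ⦄ (f : W ⟶ T),
    SmoothOfRelativeDimension 1 T.hom → IrreducibleSpace T.left → IsQuasiProjectiveOver W →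
    Flat f.left → IsProper f.left → 1 ≤ q → q ≤ d →
    ∀ S : Set T.left, IsClosed S → S ≠ Set.univ →
      (∀ t : ComplexPoints T, t.pt ∉ S → IsSmoothProjective d (fiberOver f t)) →
      ∀ c : complexBetti W (2 * q), IsRationalClass c →
        (∀ t : ComplexPoints T, t.pt ∉ S →
          complexBetti.map (fiberι f t) (2 * q) c ∈ algebraicClasses (fiberOver f t) q) →
        ∃ a : complexBetti W (2 * q), a ∈ algebraicClasses W q ∧ IsRationalClass a ∧
          ∃ S' : Set T.left, IsClosed S' ∧ S ⊆ S' ∧ S' ≠ Set.univ ∧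
            ∀ t : ComplexPoints T, t.pt ∉ S' →
              complexBetti.map (fiberι f t) (2 * q) (c - a) = 0

/-- Degree bookkeeping for the pairing `H²ᵖ(𝒳) × H^{2(q+1)}(𝒳) → H^{2(d+1)}(𝒳)` when `p + q = d` (a closed term, so that
the hypothesis shape below carries no tactic block). [folklore] -/
theorem two_mul_add_two_mul_succ_eq {p q d : ℕ} (hpq : p + q = d) : 2 * p + 2 * (q + 1) = 2 * (d + 1) := by
  omega

/-- `NumE[d, p, q]` — the "hom ≡ num" bracket of this part: on every compact pencil of abelian `d`-folds, at every
point `t` whose fibre is charted by an abelian variety isogenous to a power of a CM elliptic curve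
(`Ring2.Hypotheses.cmPowerLocus f d`), (Num_t)(p,q) — an algebraic class `j_{t*} b` (`b ∈ N^q(𝒳_t)`) cup-orthogonal
to `N^p(𝒳)` vanishes (the degree identity is the closed term `two_mul_add_two_mul_succ_eq hpq`; by proof irrelevance
this is the (Num_t) of parts XVIII-a–c verbatim). A hypothesis SHAPE (local notation), not a definition.
[cite: Kleiman1968AlgebraicCycles, §3 (D(X))] -/
local notation3 (prettyPrint := false) "NumE[" d ", " p ", " q "]" =>
  ∀ ⦃𝒳 S : SchemeOver ℂ⦄ (f : 𝒳 ⟶ S) (hf : IsCompactAbelianPencil f d) (t : ComplexPoints S),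
    t ∈ cmPowerLocus f d → ∀ (hpq : p + q = d), ∀ b ∈ algebraicClasses (fiberOver f t) q,
      (∀ a ∈ algebraicClasses 𝒳 p,
        cupProduct (two_mul_add_two_mul_succ_eq hpq) a (fiberGysin hf t q b) = 0) →
        fiberGysin hf t q b = 0

/-! ## §0 HC at an `E`-power fibre; transport out of a fibre from the lift at that fibre -/

/-- **The Hodge conjecture holds, in every degree, for a fibre charted by an abelian variety isogenous to a power of
a CM elliptic curve** (Tate's theorem / van Geemen Thm. 4.3 on `Eᴺ⁺¹`, isogeny invariance Lemma 3.7, transport along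
the chart — the tree theorem `EllipticCurve.hodgeConjectureFor_of_isIsogenous_powSucc_of_cm`; compare the hypotheses
seat's `cmPowerAnchor_valid`, the middle degree). NO `HC_CM`. [cite: vanGeemen1994HodgeAV, Lemma 3.7 and Thm. 4.3] -/
theorem hodgeConjectureFor_fiberOver_of_mem_cmPowerLocus {d : ℕ} {f : 𝒳 ⟶ S} {t : ComplexPoints S}
    (ht : t ∈ cmPowerLocus f d) : HodgeConjectureFor d (fiberOver f t) := by
  obtain ⟨A₀, E, ψ, d', N, ⟨e₀⟩, hA₀dim, hE, hd', hψ, hiso⟩ := ht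
  exact (hodgeConjectureFor_iff_of_iso e₀).1
    (hA₀dim ▸ EllipticCurve.hodgeConjectureFor_of_isIsogenous_powSucc_of_cm hE ψ hd' hψ N hiso)

/-- **Transport out of ONE fibre from the lift at that fibre** (no binder at all): on a compact pencil, if
`(j_t^*)⁻¹ N^p(𝒳_t) ≤ N^p(𝒳) ⊔ ker j_t^*` and `j_t^* W` is algebraic, then `j_s^* W` is algebraic for every `s` —
`W = η + κ` with `η` algebraic and `j_t^* κ = 0`, the kernel of `j_s^*` does not depend on `s` (part X-c,
`map_fiberι_eq_zero_of_eq_zero`), and restrictions of algebraic classes are algebraic (`map_fiberι_mem_algebraicClasses`).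
[cite: Andre1996Motifs, §5.1 (A3)–(A4) (p. 25)] [cite: Milne2020HodgeClassesAV, Prop. 1 (p. 7)] -/
theorem map_fiberι_mem_algebraicClasses_of_comap_le_sup {d : ℕ} {f : 𝒳 ⟶ S} (hf : IsCompactAbelianPencil f d)
    {p : ℕ} {t : ComplexPoints S}
    (hL : (algebraicClasses (fiberOver f t) p).comap (complexBetti.map (fiberι f t) (2 * p)).hom ≤
      algebraicClasses 𝒳 p ⊔ LinearMap.ker (complexBetti.map (fiberι f t) (2 * p)).hom)
    {W : complexBetti 𝒳 (2 * p)} (hWt : complexBetti.map (fiberι f t) (2 * p) W ∈ algebraicClasses (fiberOver f t) p)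
    (s : ComplexPoints S) :
    complexBetti.map (fiberι f s) (2 * p) W ∈ algebraicClasses (fiberOver f s) p := by
  obtain ⟨η, hη, κ, hκ, hηκ⟩ := Submodule.mem_sup.1 (hL hWt)
  rw [LinearMap.mem_ker] at hκ
  have hκt : complexBetti.map (fiberι f t) (2 * p) κ = 0 := hκ
  have hκs : complexBetti.map (fiberι f s) (2 * p) κ = 0 := map_fiberι_eq_zero_of_eq_zero hf hκt s
  have hWs : complexBetti.map (fiberι f s) (2 * p) W = complexBetti.map (fiberι f s) (2 * p) η := by
    rw [← hηκ, map_add, hκs, add_zero]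
  rw [hWs]
  haveI : IrreducibleSpace S.left := Andre1996.compactPencil_irreducibleSpace_base hf
  haveI := Andre1996.compactPencil_smooth_base hf
  exact map_fiberι_mem_algebraicClasses f hf.isSmoothProjectiveFamily
    (IsQuasiProjectiveOver.of_isProjectiveOver hf.isSmoothProjective_base.isProjectiveOver) hη s

/-! ## §1 (Num_t) ⟹ the lift at an `E`-power point, with no `HC_CM` -/

/-- **(Num_t)(p,q) ⟹ (L)_t(p) at an `E`-power point of a compact pencil of abelian `d`-folds (`p + q = d`), NO
`HC_CM`**: (Perf_t) holds there in every bidegree because HC holds on the fibre (§0 and part XVIII-b's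
`nondegenerate_algebraicClasses_fiberOver_of_hodge`), and (Perf_t) ∧ (Num_t) ⟹ (L)_t is part XVIII-a.
[cite: Kleiman1968AlgebraicCycles, §3 (D(X))] [cite: vanGeemen1994HodgeAV, Thm. 4.3] -/
theorem comap_le_sup_of_numerical_of_mem_cmPowerLocus {d : ℕ} {f : 𝒳 ⟶ S} (hf : IsCompactAbelianPencil f d)
    {t : ComplexPoints S} (ht : t ∈ cmPowerLocus f d) {p q : ℕ} (hpq : p + q = d)
    (hNum : ∀ b ∈ algebraicClasses (fiberOver f t) q,
      (∀ a ∈ algebraicClasses 𝒳 p,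
        cupProduct (show 2 * p + 2 * (q + 1) = 2 * (d + 1) by omega) a (fiberGysin hf t q b) = 0) →
        fiberGysin hf t q b = 0) :
    (algebraicClasses (fiberOver f t) p).comap (complexBetti.map (fiberι f t) (2 * p)).hom ≤
      algebraicClasses 𝒳 p ⊔ LinearMap.ker (complexBetti.map (fiberι f t) (2 * p)).hom :=
  have hHC := hodgeConjectureFor_fiberOver_of_mem_cmPowerLocus ht
  comap_le_sup_of_numerical_of_hodge hf t hpq (fun c hc hcp ↦ hHC.2 p c hc hcp) (fun c hc hcq ↦ hHC.2 q c hc hcq) hNum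

/-! ## §2 The Weil rows in "hom ≡ num" form: no `HC_CM`, no spreading, no named fact -/

/-- **CORE LEMMA (NO `HC_CM`, NO spreading, NO named fact).** Granted (W_E)ₙ and `NumE[2n, n, n]` — (Num_t)(n,n) at the
`E`-power points of compact pencils of abelian `2n`-folds —, every rational `(n,n)` Weil class on an abelian
`2n`-fold of Weil type is algebraic: on the pencil of (W_E)ₙ the restriction `W|_{𝒳_t}` to the `E`-power fibre is
algebraic by Tate's theorem (`cmPowerAnchor_valid`), (Num_t)(n,n) gives the lift at `t` (§1), the lift transports
algebraicity to `𝒳_s ≅ A.X` (§0), and the chart reads `c`. [cite: vanGeemen1994HodgeAV, Lemma 3.7 and Thm. 4.3]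
[cite: Kleiman1968AlgebraicCycles, §3 (D(X))] [cite: Andre1996Motifs, §6.3 a) and c) (p. 33)] -/
theorem mem_algebraicClasses_of_cmPowerWeilPencilsAt_of_numerical {n : ℕ} (hW : CMPowerAnchoredCompactWeilPencilsAt n)
    (hNum : NumE[2 * n, n, n]) {d : ℕ} (hd : 0 < d) {A : AbelianVariety ℂ} {φ : A ⟶ A}
    (hAdim : A.dim = 2 * n) (hA : IsSmoothProjective (2 * n) A.X) (hφ : φ ≫ φ = -(d • 𝟙 A))
    {c : complexBetti A.X (2 * n)} (hcQ : IsRationalClass c) (hcH : IsOfHodgeType (2 * n) A.X (2 * n) n n c)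
    (hcW : c ∈ weilClassesOf A φ n d) : c ∈ algebraicClasses A.X n := by
  by_cases hc0 : c = 0
  · rw [hc0]; exact Submodule.zero_mem _
  obtain ⟨𝒳, S, f, hf, s, t, W, e₁, hWH, hread, ht⟩ := hW d hd A φ hAdim hA hφ c hcQ hcH hcW hc0
  have h₀ : complexBetti.map (fiberι f t) (2 * n) W ∈ algebraicClasses (fiberOver f t) n :=
    cmPowerAnchor_valid n (fiberOver f t) _ ht (hWH t).1 (hWH t).2
  have hL := comap_le_sup_of_numerical_of_mem_cmPowerLocus hf ht (show n + n = 2 * n by omega)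
    (hNum f hf t ht (by omega))
  have h₁ := map_fiberι_mem_algebraicClasses_of_comap_le_sup hf hL h₀ s
  rw [← hread]
  exact (mem_algebraicClasses_map_iff_of_iso e₁).2 h₁

/-- **`(W_E)₃ ∧ NumE[6, 3, 3] ⟹ WeilSixfolds` — the Weil-sixfold item (stmt-HodgeConjecture-2524: Weil classes on
ALL abelian sixfolds of Weil type, every `ℚ(√-d)`, every discriminant, split or not) from ONE "hom ≡ num" statement:
on each compact pencil `𝒳⁷ → C` of abelian sixfolds with a fibre `𝒳_t ~ E⁶` (`E` CM), every algebraic class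
`j_{t*} b`, `b` a codimension-3 cycle on `𝒳_t`, which is numerically orthogonal to the codimension-3 cycles of the
7-fold `𝒳`, is homologically zero.** Equivalently (part XVIII-c `numerical_iff_detect`): every such `b` with
`j_{t*} b ≠ 0` is DETECTED by a codimension-3 cycle `a` of `𝒳`, `j_t^* a · b ≠ 0`. NO `HC_CM`, NO spreading, NO named
fact; nothing is closed. Weaker-or-equal than part IX's rows ((β′)_6, (4)_6 ⟹ NumE by §4). research route, not a
corollary; conditional on HC_CM plus one named minimal statement (here `HC_CM` is IDLE).
[cite: Kleiman1968AlgebraicCycles, §3 (D(X))] [cite: vanGeemen1994HodgeAV, Thm. 4.3 and 5.12]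
[cite: Andre1996Motifs, Lemme 6.3.3 (p. 33) and Remarque 2] -/
theorem weilSixfolds_of_cmPowerWeilPencilsAt_of_numerical (hW : CMPowerAnchoredCompactWeilPencilsAt 3)
    (hNum : NumE[6, 3, 3]) : Theses.SevenfoldWeilCensus.WeilSixfolds :=
  weilSixfolds_iff_weilClassesOf.2 fun _ hd _ _ hAdim hA hφ _ hcQ hcH hcW ↦
    mem_algebraicClasses_of_cmPowerWeilPencilsAt_of_numerical hW hNum hd hAdim hA hφ hcQ hcH hcW

/-- In particular the NON-SPLIT sixfolds follow from (W_E)₃ and `NumE[6, 3, 3]`, NO `HC_CM`.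
[cite: Markman2025SurveySecant, §12 (preprint, unrefereed)] [cite: Andre1996Motifs, Lemme 6.3.3 (p. 33)] -/
theorem nonsplitSixfolds_of_cmPowerWeilPencilsAt_of_numerical (hW : CMPowerAnchoredCompactWeilPencilsAt 3)
    (hNum : NumE[6, 3, 3]) : NonsplitSixfolds :=
  nonsplitSixfolds_of_weilSixfolds (weilSixfolds_of_cmPowerWeilPencilsAt_of_numerical hW hNum)

/-- **R∞ in "hom ≡ num" form**: `(∀ n ≥ 2, (W_E)ₙ) ∧ (∀ n ≥ 2, NumE[2n, n, n]) ⟹` every rational `(n,n)` Weil class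
on every abelian `2n`-fold of Weil type over every imaginary quadratic field is algebraic. NO `HC_CM`, NO named fact.
[cite: Weil1977HodgeRing] [cite: vanGeemen1994HodgeAV, Thm. 4.3] [cite: Kleiman1968AlgebraicCycles, §3 (D(X))] -/
theorem weilClassesImaginaryQuadratic_of_cmPowerWeilPencils_of_numerical
    (hW : ∀ n, 2 ≤ n → CMPowerAnchoredCompactWeilPencilsAt n) (hNum : ∀ n, 2 ≤ n → NumE[2 * n, n, n]) :
    WeilClassesImaginaryQuadratic :=
  fun n hn _ hd _ _ hAdim hA hφ _ hcQ hcH hcW ↦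
    mem_algebraicClasses_of_cmPowerWeilPencilsAt_of_numerical (hW n hn) (hNum n hn) hd hAdim hA hφ hcQ hcH hcW

/-! ## §3 On-path: the bracket is a case of the summit statement -/

/-- **ON-PATH: `HodgeConjecture ⟹ NumE[d, p, q]`** (the algebraic fixed part holds under the Hodge conjecture, part
VI, in the lattice form of part XVII-b; then part XVIII-c's `(L)_t ⟹ (Num_t)` at the `E`-power fibre, where HC
holds by §0). So the bracket is a CASE of the summit statement, not an independent axiom. [cite: Kleiman1968AlgebraicCycles, §3]
[cite: Andre1996Motifs, §6.3 Remarque 2 (p. 33)] -/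
theorem numericalE_of_hodgeConjecture (h : _root_.HodgeConjecture) (d p q : ℕ) : NumE[d, p, q] := by
  intro 𝒳 S f hf t ht hpq
  have hHC := hodgeConjectureFor_fiberOver_of_mem_cmPowerLocus ht
  have hL : (algebraicClasses (fiberOver f t) p).comap (complexBetti.map (fiberι f t) (2 * p)).hom ≤
      algebraicClasses 𝒳 p ⊔ LinearMap.ker (complexBetti.map (fiberι f t) (2 * p)).hom :=
    (algebraicFixedPart_iff_comap_eq_sup.1 (algebraicFixedPart_of_hodgeConjecture h) f hf p t).le
  exact numerical_of_comap_le_sup_of_hodge hf t hpq (fun c hc hcp ↦ hHC.2 p c hc hcp) hL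

/-! ## §4 The bracket from HC of the fibres plus spreading; comparison with part IX -/

/-- **`HCAtDim d ∧ SpreadCurve[] ⟹ NumE[d, p, q]`** (part XIX-b's `numerical_of_hcAtDim` at the `E`-power points): the
bracket follows from the Hodge conjecture for abelian `d`-folds ALONE modulo the classical spreading — for `d = 6`
from `HCAtDim 6`, to which `WeilSixfolds` contributes the Weil-type cells (sub-cell census). [cite: Kleiman1968AlgebraicCycles, §3]
[cite: VoisinHodgeII2003, §3.3.1 and §10.2.1, proof of Thm. 10.19] -/
theorem numericalE_of_hcAtDim (hSp : SpreadCurve[]) {d : ℕ} (h : HCAtDim d) (p q : ℕ) : NumE[d, p, q] :=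
  fun _ _ _ hf t _ hpq ↦ numerical_of_hcAtDim hSp h hf t hpq

/-- **Part IX's transport input implies the new bracket, granted spreading**: `CMAnchoredTransportAtRelDim d ∧
SpreadCurve[] ⟹ NumE[d, p, q]` (an `E`-power point is a CM point; transport from it makes every class with rational
`(p,p)` restrictions algebraic on every fibre; part XIX-e's `comap_le_sup_of_forall_mem_algebraicClasses` pattern via
part XIX-a's engine gives the lift; part XVIII-c converts it to (Num_t) at the HC fibre). So the rows of §2 are
WEAKER-OR-EQUAL (as hypotheses) than part IX's, modulo the spreading lemma. [cite: Andre1996Motifs, §6.3 a) (p. 33)]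
[cite: VoisinHodgeII2003, §3.3.1] -/
theorem numericalE_of_cmAnchoredTransportAtRelDim (hSp : SpreadCurve[]) {d : ℕ} (hT : CMAnchoredTransportAtRelDim d)
    (p q : ℕ) : NumE[d, p, q] := by
  intro 𝒳 S f hf t ht hpq
  have hHC := hodgeConjectureFor_fiberOver_of_mem_cmPowerLocus ht
  have htcm := mem_cmLocus_of_mem_cmPowerLocus ht
  -- every class with rational `(p',p')` restrictions is algebraic at `t` (HC there), hence everywhere (transport)
  have hIHC : ∀ (p' : ℕ) (W : complexBetti 𝒳 (2 * p')),
      (∀ s : ComplexPoints S, IsRationalClass (complexBetti.map (fiberι f s) (2 * p') W) ∧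
        IsOfHodgeType d (fiberOver f s) (2 * p') p' p' (complexBetti.map (fiberι f s) (2 * p') W)) →
      ∀ s : ComplexPoints S, complexBetti.map (fiberι f s) (2 * p') W ∈ algebraicClasses (fiberOver f s) p' :=
    fun p' W hW s ↦ hT f hf p' W hW t htcm (hHC.2 p' _ (hW t).1 (hW t).2) s
  have hL := comap_le_sup_of_forall_mem_algebraicClasses hSp hf hIHC p t
  exact numerical_of_comap_le_sup_of_hodge hf t hpq (fun c hc hcp ↦ hHC.2 p c hc hcp) hL

/-! ## §5 Pencil by pencil at an `E`-power point: hom ≡ num ⟺ Abdulali's transport, with no `HC_CM` -/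

/-- **At an `E`-power point, the lift at `t` in every codimension makes every global class with rational `(p,p)`
fibre restrictions algebraic on EVERY fibre — NO `HC_CM`** (the anchor is valid by Tate's theorem, §0; then
`map_fiberι_mem_algebraicClasses_of_comap_le_sup`). [cite: vanGeemen1994HodgeAV, Thm. 4.3]
[cite: Andre1996Motifs, §5.1 (A3)–(A4) (p. 25)] -/
theorem forall_mem_algebraicClasses_of_comap_le_sup_of_mem_cmPowerLocus {d : ℕ} {f : 𝒳 ⟶ S}
    (hf : IsCompactAbelianPencil f d) {t : ComplexPoints S} (ht : t ∈ cmPowerLocus f d)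
    (hL : ∀ p : ℕ, (algebraicClasses (fiberOver f t) p).comap (complexBetti.map (fiberι f t) (2 * p)).hom ≤
      algebraicClasses 𝒳 p ⊔ LinearMap.ker (complexBetti.map (fiberι f t) (2 * p)).hom)
    (p : ℕ) (W : complexBetti 𝒳 (2 * p))
    (hW : ∀ s : ComplexPoints S, IsRationalClass (complexBetti.map (fiberι f s) (2 * p) W) ∧
      IsOfHodgeType d (fiberOver f s) (2 * p) p p (complexBetti.map (fiberι f s) (2 * p) W))
    (s : ComplexPoints S) :
    complexBetti.map (fiberι f s) (2 * p) W ∈ algebraicClasses (fiberOver f s) p :=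
  map_fiberι_mem_algebraicClasses_of_comap_le_sup hf (hL p)
    ((hodgeConjectureFor_fiberOver_of_mem_cmPowerLocus ht).2 p _ (hW t).1 (hW t).2) s

/-- **PENCIL BY PENCIL AT AN `E`-POWER POINT, NO `HC_CM` (granted `SpreadCurve[]` for one direction): conjecture D
for the cycles of the total space supported on the `E`-power fibre, in every bidegree, ⟺ Abdulali's transport
(1.1)_f on this pencil.** (⟹, spreading-free: §1 lift in every codimension — the empty codimensions `p > d` are
trivial —, then the previous theorem, then forget the anchor; ⟸: the `E`-power fibre is an anchor, so every class
with rational `(p,p)` restrictions is algebraic on every fibre, part XIX-e's `comap_le_sup_of_forall_mem_algebraicClasses`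
lifts, and part XVIII-c converts the lift to (Num_t) at the HC fibre.) On a CM-power-anchored pencil of Weil-type
sixfolds the right-hand side contains the algebraicity of the invariant Weil classes on EVERY member.
[cite: Kleiman1968AlgebraicCycles, §3 (D(X))] [cite: Abdulali1994FamiliesAV, (1.1) (p. 1122)]
[cite: vanGeemen1994HodgeAV, Thm. 4.3] [cite: VoisinHodgeII2003, §3.3.1 and §10.2.1, proof of Thm. 10.19] -/
theorem numerical_iff_invariantCyclesHoldFor_of_mem_cmPowerLocus (hSp : SpreadCurve[]) {d : ℕ} {f : 𝒳 ⟶ S}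
    (hf : IsCompactAbelianPencil f d) {t : ComplexPoints S} (ht : t ∈ cmPowerLocus f d) :
    (∀ (p q : ℕ) (hpq : p + q = d), ∀ b ∈ algebraicClasses (fiberOver f t) q,
      (∀ a ∈ algebraicClasses 𝒳 p,
        cupProduct (two_mul_add_two_mul_succ_eq hpq) a (fiberGysin hf t q b) = 0) →
        fiberGysin hf t q b = 0) ↔
      Literature.AlgebraicGeometry.Abdulali1994.InvariantCyclesHoldFor f d := by
  have hHC := hodgeConjectureFor_fiberOver_of_mem_cmPowerLocus ht
  constructor
  · intro h
    have hL : ∀ p : ℕ, (algebraicClasses (fiberOver f t) p).comap (complexBetti.map (fiberι f t) (2 * p)).hom ≤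
        algebraicClasses 𝒳 p ⊔ LinearMap.ker (complexBetti.map (fiberι f t) (2 * p)).hom := by
      intro p
      rcases le_or_gt p d with hp | hp
      · exact comap_le_sup_of_numerical_of_mem_cmPowerLocus hf ht (show p + (d - p) = d by omega)
          (h p (d - p) (by omega))
      · haveI := subsingleton_complexBetti (hf.isSmoothProjective_fiberOver t) (show 2 * d < 2 * p by omega)
        intro W _
        refine Submodule.mem_sup_right ?_
        rw [LinearMap.mem_ker]
        exact Subsingleton.elim _ _
    exact invariantCyclesHoldFor_of_forall_mem_algebraicClasses fun p W hW s ↦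
      forall_mem_algebraicClasses_of_comap_le_sup_of_mem_cmPowerLocus hf ht hL p W hW s
  · intro hT p q hpq
    have hIHC : ∀ (p' : ℕ) (W : complexBetti 𝒳 (2 * p')),
        (∀ s : ComplexPoints S, IsRationalClass (complexBetti.map (fiberι f s) (2 * p') W) ∧
          IsOfHodgeType d (fiberOver f s) (2 * p') p' p' (complexBetti.map (fiberι f s) (2 * p') W)) →
        ∀ s : ComplexPoints S, complexBetti.map (fiberι f s) (2 * p') W ∈ algebraicClasses (fiberOver f s) p' :=
      fun p' W hW s ↦ hT p' W hW ⟨t, hHC.2 p' _ (hW t).1 (hW t).2⟩ s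
    exact numerical_of_comap_le_sup_of_hodge hf t hpq (fun c hc hcp ↦ hHC.2 p c hc hcp)
      (comap_le_sup_of_forall_mem_algebraicClasses hSp hf hIHC p t)

end Summit.HodgeConjecture.HodgeConjecture.Ring2.AbelianAll

end
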